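import Summits.ResolutionOfSingularities.ResolutionOfSingularities.Theorems.HomologicalConductorNoZenoCaOneCyclicCeiling
import Literature.RingTheory.CohomologyAnnihilator.SocleAnnihilates
import HarnessLib

/-!
# Crux `NoZenoR` (stmt-ResolutionOfSingularities-19943), T_ST — `ca¹ = 𝔪²` for local rings of the shape of `k[x,y]/(x,y)³`

Route `ResolutionOfSingularities/HomologicalConductor`, chain W4.4, KERNEL-g22 THEOREM 22.2 (a) (lead g22). `[OURS]` — AI-formalised,
weaker than expert review; NOT a statement of any manuscript under review.

Abstract form of the first half of the dimension-zero counterexample to «ca = ca^{dim+1}»: let `(R, 𝔪)` be a local ring with `𝔪³ = 0`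
possessing two elements `x, y` with `ann(x), ann(y) ⊆ 𝔪²` and `((x) + 𝔪²) ∩ ((y) + 𝔪²) ⊆ 𝔪²` (all three hold in `k[x,y]/(x,y)³`, where
`ann(x) = ann(y) = 𝔪²` and `(x) + 𝔪²`, `(y) + 𝔪²` meet in `𝔪²`). Then

  `cohomologyAnnihilatorOfDegree R 1 = 𝔪²`  (`cohomologyAnnihilatorOfDegree_one_eq_maximalIdeal_sq`):

the floor `𝔪² ⊆ ca¹` is Iyengar–Takahashi's Example 2.6 (`Literature/…/SocleAnnihilates`, socle = `𝔪²` as `𝔪³ = 0`), the ceiling is the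
cyclic ceiling `ca¹ ⊆ (I + ann I)` of `…NoZenoCaOneCyclicCeiling` applied to `I = (x)` and `I = (y)`.
(The second half, `ca²(k[x,y]/(x,y)³) = 𝔪`, is KERNEL-g22 §2 (b), a hand theorem.)
-/

noncomputable section

-- single-problem summit: the doubled namespace component is forced
set_option linter.dupNamespace false

open Literature.RingTheory.CohomologyAnnihilator
open Summit.ResolutionOfSingularities.ResolutionOfSingularities.Theorems.NoZeno.CyclicCeiling

universe u

namespace Summit.ResolutionOfSingularities.ResolutionOfSingularities.Theorems.NoZeno.CaOneCubeZero

variable {R : Type u} [CommRing R]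

/-- Ceiling from one element: if `ann(x) ⊆ J` then `ca¹(R) ⊆ (x) + J` (cyclic ceiling for the principal ideal `(x)`).
[this work; KERNEL-g22 THEOREM 22.2 (a)] -/
theorem cohomologyAnnihilatorOfDegree_one_le_span_sup {x : R} {J : Ideal R}
    (hx : (Ideal.span {x}).annihilator ≤ J) :
    cohomologyAnnihilatorOfDegree R 1 ≤ Ideal.span {x} ⊔ J := by
  intro c hc
  have h := mem_sup_annihilator_of_mem_cohomologyAnnihilatorOfDegree_one (Ideal.span {x})
    ⟨{x}, by simp⟩ hc
  exact (sup_le_sup_left hx _) h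

/-- **`ca¹ = 𝔪²`** for a local ring `(R, 𝔪)` with `𝔪³ = 0` and two elements `x, y` such that `ann(x), ann(y) ⊆ 𝔪²` and
`((x) + 𝔪²) ∩ ((y) + 𝔪²) ⊆ 𝔪²` — the shape of `k[x,y]/(x,y)³`. [this work; KERNEL-g22 THEOREM 22.2 (a)] -/
theorem cohomologyAnnihilatorOfDegree_one_eq_maximalIdeal_sq [IsLocalRing R] (h3 : IsLocalRing.maximalIdeal R ^ 3 = ⊥) {x y : R}
    (hx : (Ideal.span {x}).annihilator ≤ IsLocalRing.maximalIdeal R ^ 2)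
    (hy : (Ideal.span {y}).annihilator ≤ IsLocalRing.maximalIdeal R ^ 2)
    (hxy : (Ideal.span {x} ⊔ IsLocalRing.maximalIdeal R ^ 2) ⊓ (Ideal.span {y} ⊔ IsLocalRing.maximalIdeal R ^ 2) ≤
      IsLocalRing.maximalIdeal R ^ 2) :
    cohomologyAnnihilatorOfDegree R 1 = IsLocalRing.maximalIdeal R ^ 2 := by
  apply le_antisymm
  · exact le_trans (le_inf (cohomologyAnnihilatorOfDegree_one_le_span_sup hx)
      (cohomologyAnnihilatorOfDegree_one_le_span_sup hy)) hxy
  · have h := maximalIdeal_pow_le_cohomologyAnnihilatorOfDegree_one (R := R) (ℓ := 3) (by norm_num) h3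
    simpa using h

end Summit.ResolutionOfSingularities.ResolutionOfSingularities.Theorems.NoZeno.CaOneCubeZero
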